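import Literature.NumberTheory.Transcendental.AyoubRelative
import Mathlib.RingTheory.Algebraic.Integral
import Mathlib.Algebra.MonoidAlgebra.Division

/-!
# Ayoub's relative Kontsevich–Zagier theorem (revisited) — algebraicity of the generators

Sibling of `Literature/NumberTheory/Transcendental/AyoubRelative.lean` (objects `O k = 𝒪 =
k[z, t, t⁻¹]`, `intO = ∫`, `dz i = ∂/∂zᵢ`, `restr i c = (·)|_{zᵢ=c}`, `euler j = tⱼ∂/∂tⱼ`,
`relA i = ∂/∂zᵢ - (·)|_{zᵢ=1} + (·)|_{zᵢ=0}`, coefficientwise `mapCoeff`, term-by-term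
`intLaurent`, `Odagger k = 𝒪†_alg ⊂ 𝒪((ϖ))`, `ayoubGenerators k`, and the NAMED FACT
`Literature.NumberTheory.Transcendental.AyoubRel.ayoub_relativeKZ_revisited`) — J. Ayoub, *La version relative de la conjecture des
périodes de Kontsevich–Zagier revisitée*, Tohoku Math. J. (2) 71 (2019) 465–485, **Théorème 1.7**:
"le noyau de `∫ : 𝒪†_alg(𝔸^∞ × 𝔼^∞) → k((ϖ))` est le sous-`k`-espace vectoriel engendré par
(a) `∂G/∂zᵢ - G|_{zᵢ=1} + G|_{zᵢ=0}`, (b) `tⱼ ∂H/∂tⱼ`, `G, H ∈ 𝒪†_alg`".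

The printed statement is an equality of two subsets of `𝒪((ϖ))` and thus PRESUPPOSES that the
generators (a), (b) — derivatives and restrictions of algebraic Laurent series — are again in
`𝒪†_alg` (Notation 1.6: the elements of `𝒪((ϖ))` algebraic over `Frac(𝒪)(ϖ)`). The vendored
fact only quantifies over `F ∈ 𝒪†_alg` and is silent on this point. This file supplies the
missing (folklore, but not formal-trivial) algebra, unconditionally and sorry-free, and derives
the printed form of Théorème 1.7 from the named fact:

* **A.** `IsAlgebraicLaurent k F ↔ IsAlgebraic 𝒪[ϖ] F` for Mathlib's `𝒪[ϖ]`-algebra structure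
  on `𝒪((ϖ))` (`isAlgebraicLaurent_iff`): the vendored `polyToLaurent` IS Mathlib's `algebraMap`.
* **B.** `𝒪†_alg` is a `k`-subalgebra of the domain `𝒪((ϖ))`: closed under `0, 1, +, -, *, ^, k•`,
  contains `𝒪[ϖ]` (Mathlib: algebraic elements over a domain form a subalgebra).
* **C.** *Derivations preserve `𝒪†_alg`* (`mapCoeff_mem_odagger_of_leibniz`): for a `k`-linear
  derivation `D` of `𝒪`, the coefficientwise `D` is a derivation of `𝒪((ϖ))` mapping `𝒪[ϖ]` into
  itself; differentiating an annihilating polynomial of minimal degree, `P^D(F) + P'(F)·DF = 0`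
  with `P'(F) ≠ 0` in characteristic `0`. `∂/∂zᵢ` and `tⱼ∂/∂tⱼ` are derivations (`dz_mul`,
  `euler_mul`).
* **D.** *Restrictions `zᵢ = c` preserve `𝒪†_alg`* (`mapCoeff_restr_mem_odagger`): unfold
  algebraicity into a non-trivial relation `Σ c(m,n) ϖ^m F^n = 0` with `c(m,n) ∈ 𝒪`
  (`exists_relation_of_mem_odagger`, `mem_odagger_of_relation`); injective `k`-algebra
  endomorphisms of `𝒪` (translations `zᵢ ↦ zᵢ + c`, `exists_translate`) transport such relations;
  for `zᵢ ↦ 0` first divide all `c(m,n)` by their largest common power `zᵢ^r`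
  (`AddMonoidAlgebra.divOf`), so that some quotient has a `zᵢ`-free monomial and survives.
* **E.** `ayoubGenerators k ⊆ Odagger k`, `span_k ⊆ Odagger k`, and
  `ayoub_relativeKZ_revisited.ker_eq_span`: the fact implies the printed equality
  `{F ∈ 𝒪†_alg | ∫ F = 0} = span_k (generators)`.

Only theorems (no new definitions); everything over an arbitrary field `k` (`CharZero k` where
derivatives are involved).

## References

* J. Ayoub, *La version relative de la conjecture des périodes de Kontsevich–Zagier revisitée*,
  Tohoku Math. J. (2) 71 (2019), no. 3, 465–485, doi:10.2748/tmj/1568772181 (preprint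
  `rel-KZ-bis`, Univ. Zürich): Notation 1.6, Théorème 1.7 (bib key `AyoubRelKZRevisited`).
* J. Ayoub, *Une version relative de la conjecture des périodes de Kontsevich–Zagier*, Ann. of
  Math. (2) 181 (2015) 905–992, §4 (the analytic analogue `𝒪†_{k-alg}(𝔻̄^∞)`).
-/

noncomputable section

open Polynomial

namespace Literature.NumberTheory.Transcendental.AyoubRel

variable {k : Type} [Field k]

/-! ### A. `𝒪†_alg` and Mathlib's `IsAlgebraic` over `𝒪[ϖ]` -/

/-- The vendored `𝒪[ϖ] → 𝒪((ϖ))`, `ϖ ↦ ϖ`, is Mathlib's structure map (`𝒪[ϖ] → 𝒪[[ϖ]] → 𝒪((ϖ))`).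
[folklore] -/
theorem polyToLaurent_toRingHom_eq_algebraMap :
    (polyToLaurent k).toRingHom = algebraMap (Polynomial (O k)) (LaurentSeries (O k)) := by
  refine Polynomial.ringHom_ext (fun c => ?_) ?_
  · rw [AlgHom.toRingHom_eq_coe, AlgHom.coe_toRingHom, polyToLaurent, Polynomial.aeval_C,
      HahnSeries.algebraMap_apply', PowerSeries.algebraMap_eq, HahnSeries.ofPowerSeries_C,
      Polynomial.algebraMap_hahnSeries_apply, Polynomial.coe_C, HahnSeries.ofPowerSeries_C]
  · rw [AlgHom.toRingHom_eq_coe, AlgHom.coe_toRingHom, polyToLaurent, Polynomial.aeval_X,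
      Polynomial.algebraMap_hahnSeries_apply, Polynomial.coe_X, HahnSeries.ofPowerSeries_X]

/-- Pointwise form of `polyToLaurent_toRingHom_eq_algebraMap`. [folklore] -/
theorem polyToLaurent_apply (p : Polynomial (O k)) :
    polyToLaurent k p = algebraMap (Polynomial (O k)) (LaurentSeries (O k)) p := by
  rw [← polyToLaurent_toRingHom_eq_algebraMap]; rfl

/-- **`𝒪†_alg` = Mathlib-algebraic elements of `𝒪((ϖ))` over `𝒪[ϖ]`** (Notation 1.6: algebraic
over `Frac(𝒪)(ϖ) = Frac(𝒪[ϖ])`, denominators cleared).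
[Ayoub, revisited note, Notation 1.6] [cite: AyoubRelKZRevisited, Notation 1.6] -/
theorem isAlgebraicLaurent_iff (F : LaurentSeries (O k)) :
    IsAlgebraicLaurent k F ↔ IsAlgebraic (Polynomial (O k)) F := by
  unfold IsAlgebraicLaurent IsAlgebraic
  simp only [polyToLaurent_toRingHom_eq_algebraMap, Polynomial.aeval_def]

/-- Membership in `𝒪†_alg` is Mathlib-algebraicity over `𝒪[ϖ]`.
[Ayoub, revisited note, Notation 1.6] [cite: AyoubRelKZRevisited, Notation 1.6] -/
theorem mem_odagger_iff (F : LaurentSeries (O k)) :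
    F ∈ Odagger k ↔ IsAlgebraic (Polynomial (O k)) F :=
  isAlgebraicLaurent_iff F

/-! ### B. `𝒪†_alg` is a `k`-subalgebra of `𝒪((ϖ))` containing `𝒪[ϖ]` -/

/-- `𝒪[ϖ] ⊆ 𝒪†_alg`. [folklore] -/
theorem algebraMap_mem_odagger (p : Polynomial (O k)) :
    algebraMap (Polynomial (O k)) (LaurentSeries (O k)) p ∈ Odagger k :=
  (mem_odagger_iff _).mpr (isAlgebraic_algebraMap p)

/-- Constants `c ∈ 𝒪` are in `𝒪†_alg`. [folklore] -/
theorem hahnC_mem_odagger (c : O k) : HahnSeries.C c ∈ Odagger k := by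
  have := algebraMap_mem_odagger (k := k) (Polynomial.C c)
  rwa [Polynomial.algebraMap_hahnSeries_apply, Polynomial.coe_C, HahnSeries.ofPowerSeries_C] at this

/-- `ϖ ∈ 𝒪†_alg`. [folklore] -/
theorem varpi_mem_odagger : (HahnSeries.single 1 1 : LaurentSeries (O k)) ∈ Odagger k := by
  have := algebraMap_mem_odagger (k := k) (X : Polynomial (O k))
  rwa [Polynomial.algebraMap_hahnSeries_apply, Polynomial.coe_X, HahnSeries.ofPowerSeries_X] at this

/-- `0 ∈ 𝒪†_alg`. [folklore] -/
theorem zero_mem_odagger : (0 : LaurentSeries (O k)) ∈ Odagger k :=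
  (mem_odagger_iff _).mpr isAlgebraic_zero

/-- `1 ∈ 𝒪†_alg`. [folklore] -/
theorem one_mem_odagger : (1 : LaurentSeries (O k)) ∈ Odagger k :=
  (mem_odagger_iff _).mpr isAlgebraic_one

/-- `𝒪†_alg` is closed under addition (`𝒪[ϖ]` is a domain). [folklore] -/
theorem add_mem_odagger {F G : LaurentSeries (O k)} (hF : F ∈ Odagger k) (hG : G ∈ Odagger k) :
    F + G ∈ Odagger k :=
  (mem_odagger_iff _).mpr (((mem_odagger_iff _).mp hF).add ((mem_odagger_iff _).mp hG))

/-- `𝒪†_alg` is closed under negation. [folklore] -/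
theorem neg_mem_odagger {F : LaurentSeries (O k)} (hF : F ∈ Odagger k) : -F ∈ Odagger k :=
  (mem_odagger_iff _).mpr ((mem_odagger_iff _).mp hF).neg

/-- `𝒪†_alg` is closed under subtraction. [folklore] -/
theorem sub_mem_odagger {F G : LaurentSeries (O k)} (hF : F ∈ Odagger k) (hG : G ∈ Odagger k) :
    F - G ∈ Odagger k :=
  (mem_odagger_iff _).mpr (((mem_odagger_iff _).mp hF).sub ((mem_odagger_iff _).mp hG))

/-- `𝒪†_alg` is closed under multiplication (`𝒪[ϖ]` is a domain). [folklore] -/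
theorem mul_mem_odagger {F G : LaurentSeries (O k)} (hF : F ∈ Odagger k) (hG : G ∈ Odagger k) :
    F * G ∈ Odagger k :=
  (mem_odagger_iff _).mpr (((mem_odagger_iff _).mp hF).mul ((mem_odagger_iff _).mp hG))

/-- `𝒪†_alg` is closed under powers. [folklore] -/
theorem pow_mem_odagger {F : LaurentSeries (O k)} (hF : F ∈ Odagger k) (n : ℕ) :
    F ^ n ∈ Odagger k :=
  (mem_odagger_iff _).mpr (((mem_odagger_iff _).mp hF).pow n)

/-- `𝒪†_alg` is closed under scalars from `k` (Notation 1.6: "sous-`k`-espace vectoriel").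
[Ayoub, revisited note, Notation 1.6] [folklore] -/
theorem smul_mem_odagger (c : k) {F : LaurentSeries (O k)} (hF : F ∈ Odagger k) :
    c • F ∈ Odagger k := by
  have h : c • F = HahnSeries.C (algebraMap k (O k) c) * F := by
    rw [HahnSeries.C_mul_eq_smul, algebraMap_smul]
  rw [h]
  exact mul_mem_odagger (hahnC_mem_odagger _) hF

/-- `𝒪†_alg` is closed under finite sums. [folklore] -/
theorem sum_mem_odagger {ι : Type} (s : Finset ι) (F : ι → LaurentSeries (O k))
    (h : ∀ i ∈ s, F i ∈ Odagger k) : ∑ i ∈ s, F i ∈ Odagger k := by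
  classical
  induction s using Finset.induction_on with
  | empty => simpa using zero_mem_odagger (k := k)
  | insert a s ha ih =>
    rw [Finset.sum_insert ha]
    exact add_mem_odagger (h a (Finset.mem_insert_self a s))
      (ih fun i hi => h i (Finset.mem_insert_of_mem hi))

/-- `𝒪†_alg` is (the carrier of) a `k`-submodule of `𝒪((ϖ))` — existence form, so that this
theorems-only file introduces no definition. [Ayoub, revisited note, Notation 1.6] [folklore] -/
theorem exists_submodule_coe_eq_odagger :
    ∃ S : Submodule k (LaurentSeries (O k)), (S : Set (LaurentSeries (O k))) = Odagger k :=
  ⟨{ carrier := Odagger k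
     add_mem' := add_mem_odagger
     zero_mem' := zero_mem_odagger
     smul_mem' := fun c _ h => smul_mem_odagger c h }, rfl⟩

/-! ### Operators on `𝒪`: Leibniz rules and multiplicativity -/

/-- Monomials multiply by adding exponents. [folklore] -/
theorem mono_mul_mono (m m' : Mono) : mono k m * mono k m' = mono k (m + m') := by
  rw [mono, mono, mono, AddMonoidAlgebra.single_mul_single, mul_one]

/-- `1 = z^0 t^0`. [folklore] -/
theorem mono_zero : mono k 0 = 1 := by
  rw [mono, AddMonoidAlgebra.one_def]

/-- Bilinear identities on `𝒪` can be checked on pairs of monomials. [folklore] -/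
theorem linearMap₂_ext_mono {B₁ B₂ : O k →ₗ[k] O k →ₗ[k] O k}
    (h : ∀ m m' : Mono, B₁ (mono k m) (mono k m') = B₂ (mono k m) (mono k m')) : B₁ = B₂ :=
  (AddMonoidAlgebra.basis Mono k).ext fun m => (AddMonoidAlgebra.basis Mono k).ext fun m' => by
    simpa only [AddMonoidAlgebra.basis_apply, mono] using h m m'

/-- A bilinear identity `D(fg) = (Df)g + f(Dg)` holds on `𝒪` as soon as it holds on monomials.
[folklore] -/
theorem leibniz_of_mono (D : O k →ₗ[k] O k)
    (h : ∀ m m' : Mono, D (mono k m * mono k m') = D (mono k m) * mono k m' + mono k m * D (mono k m'))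
    (f g : O k) : D (f * g) = D f * g + f * D g := by
  have key : (LinearMap.mul k (O k)).compr₂ D =
      (LinearMap.mul k (O k)).comp D + (LinearMap.mul k (O k)).compl₂ D :=
    linearMap₂_ext_mono fun m m' => by
      simpa only [LinearMap.compr₂_apply, LinearMap.mul_apply', LinearMap.add_apply,
        LinearMap.comp_apply, LinearMap.compl₂_apply] using h m m'
  simpa only [LinearMap.compr₂_apply, LinearMap.mul_apply', LinearMap.add_apply,
    LinearMap.comp_apply, LinearMap.compl₂_apply] using
    congrArg (fun B : O k →ₗ[k] O k →ₗ[k] O k => B f g) key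

/-- A bilinear identity `ρ(fg) = ρ(f)ρ(g)` holds on `𝒪` as soon as it holds on monomials.
[folklore] -/
theorem map_mul_of_mono (ρ : O k →ₗ[k] O k)
    (h : ∀ m m' : Mono, ρ (mono k m * mono k m') = ρ (mono k m) * ρ (mono k m'))
    (f g : O k) : ρ (f * g) = ρ f * ρ g := by
  have key : (LinearMap.mul k (O k)).compr₂ ρ = ((LinearMap.mul k (O k)).comp ρ).compl₂ ρ :=
    linearMap₂_ext_mono fun m m' => by
      simpa only [LinearMap.compr₂_apply, LinearMap.mul_apply', LinearMap.comp_apply,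
        LinearMap.compl₂_apply] using h m m'
  simpa only [LinearMap.compr₂_apply, LinearMap.mul_apply', LinearMap.comp_apply,
    LinearMap.compl₂_apply] using congrArg (fun B : O k →ₗ[k] O k →ₗ[k] O k => B f g) key

/-- **`tⱼ ∂/∂tⱼ` is a derivation of `𝒪`.** [folklore] -/
theorem euler_mul (j : ℕ) (f g : O k) :
    euler k j (f * g) = euler k j f * g + f * euler k j g := by
  refine leibniz_of_mono (euler k j) (fun m m' => ?_) f g
  simp only [mono_mul_mono, euler_mono, smul_mul_assoc, mul_smul_comm, Prod.snd_add,
    Finsupp.add_apply, Int.cast_add, add_smul]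

/-- **`∂/∂zᵢ` is a derivation of `𝒪`.** [folklore] -/
theorem dz_mul (i : ℕ) (f g : O k) : dz k i (f * g) = dz k i f * g + f * dz k i g := by
  refine leibniz_of_mono (dz k i) (fun m m' => ?_) f g
  obtain ⟨a, b⟩ := m
  obtain ⟨a', b'⟩ := m'
  simp only [mono_mul_mono, dz_mono, smul_mul_assoc, mul_smul_comm, Prod.mk_add_mk,
    Finsupp.add_apply, Nat.cast_add, add_smul]
  -- ⊢ (a i)•mono(a+a'-e, b+b') + (a' i)•mono(a+a'-e, b+b')
  --     = (a i)•mono(a-e+a', b+b') + (a' i)•mono(a+(a'-e), b+b')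
  congr 1
  · rcases Nat.eq_zero_or_pos (a i) with h | h
    · rw [h, Nat.cast_zero, zero_smul, zero_smul]
    · rw [tsub_add_eq_add_tsub (Finsupp.single_le_iff.mpr h)]
  · rcases Nat.eq_zero_or_pos (a' i) with h | h
    · rw [h, Nat.cast_zero, zero_smul, zero_smul]
    · rw [← add_tsub_assoc_of_le (Finsupp.single_le_iff.mpr h)]

/-- **`zᵢ ↦ c` is multiplicative on `𝒪`.** [folklore] -/
theorem restr_mul (i : ℕ) (c : k) (f g : O k) :
    restr k i c (f * g) = restr k i c f * restr k i c g := by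
  refine map_mul_of_mono (restr k i c) (fun m m' => ?_) f g
  obtain ⟨a, b⟩ := m
  obtain ⟨a', b'⟩ := m'
  simp only [mono_mul_mono, restr_mono, mul_smul_comm, smul_smul, Prod.mk_add_mk,
    Finsupp.add_apply, pow_add, Finsupp.erase_add, mul_comm]

/-- … and unital. [folklore] -/
theorem restr_one (i : ℕ) (c : k) : restr k i c 1 = 1 := by
  rw [← mono_zero, restr_mono]
  simp only [Prod.fst_zero, Finsupp.coe_zero, Pi.zero_apply, pow_zero, Finsupp.erase_zero,
    Prod.snd_zero, one_smul]
  rfl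


/-! ### C. Coefficientwise maps: linear, multiplicative, derivations -/

section mapCoeff

variable {V W : Type} [AddCommGroup V] [Module k V] [AddCommGroup W] [Module k W]

/-- Coefficients of a coefficientwise image (definitional). [folklore] -/
theorem mapCoeff_coeff (f : V →ₗ[k] W) (F : LaurentSeries V) (n : ℤ) :
    (mapCoeff k f F).coeff n = f (F.coeff n) := rfl

/-- The support can only shrink under a coefficientwise map. [folklore] -/
theorem support_mapCoeff_subset (f : V →ₗ[k] W) (F : LaurentSeries V) :
    (mapCoeff k f F).support ⊆ F.support := by
  intro n hn
  simp only [HahnSeries.mem_support, mapCoeff_coeff, ne_eq] at hn ⊢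
  intro h
  exact hn (by rw [h, map_zero])

/-- Coefficientwise maps on monomials `v ϖ^n`. [folklore] -/
theorem mapCoeff_hahnSingle (f : V →ₗ[k] W) (n : ℤ) (v : V) :
    mapCoeff k f (HahnSeries.single n v) = HahnSeries.single n (f v) := by
  ext m
  rw [mapCoeff_coeff]
  by_cases h : m = n
  · subst h; rw [HahnSeries.coeff_single_same, HahnSeries.coeff_single_same]
  · rw [HahnSeries.coeff_single_of_ne h, HahnSeries.coeff_single_of_ne h, map_zero]

/-- `(f + g)_* = f_* + g_*` coefficientwise. [folklore] -/
theorem mapCoeff_add_map (f g : V →ₗ[k] W) (F : LaurentSeries V) :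
    mapCoeff k (f + g) F = mapCoeff k f F + mapCoeff k g F := by
  ext n; rfl

/-- `(f - g)_* = f_* - g_*` coefficientwise. [folklore] -/
theorem mapCoeff_sub_map (f g : V →ₗ[k] W) (F : LaurentSeries V) :
    mapCoeff k (f - g) F = mapCoeff k f F - mapCoeff k g F := by
  ext n; rfl

/-- Functoriality of coefficientwise maps. [folklore] -/
theorem mapCoeff_comp_apply {U : Type} [AddCommGroup U] [Module k U] (g : V →ₗ[k] W)
    (f : U →ₗ[k] V) (F : LaurentSeries U) :
    mapCoeff k (g ∘ₗ f) F = mapCoeff k g (mapCoeff k f F) := by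
  ext n; rfl

end mapCoeff

section multiplicative

variable (φ : O k →ₗ[k] O k)

/-- A `k`-linear MULTIPLICATIVE map of `𝒪` acts multiplicatively on `𝒪((ϖ))` coefficientwise
(it is `HahnSeries.map` of the corresponding non-unital ring hom). [folklore] -/
theorem mapCoeff_mul_of_map_mul (hφ : ∀ f g : O k, φ (f * g) = φ f * φ g)
    (F G : LaurentSeries (O k)) :
    mapCoeff k φ (F * G) = mapCoeff k φ F * mapCoeff k φ G := by
  let ρ : O k →ₙ+* O k :=
    { toFun := φ, map_mul' := hφ, map_zero' := map_zero φ, map_add' := map_add φ }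
  exact HahnSeries.map_mul ρ (x := F) (y := G)

/-- … and hence on powers, when it is also unital. [folklore] -/
theorem mapCoeff_pow_of_map_mul (h1 : φ 1 = 1) (hφ : ∀ f g : O k, φ (f * g) = φ f * φ g)
    (F : LaurentSeries (O k)) (n : ℕ) :
    mapCoeff k φ (F ^ n) = mapCoeff k φ F ^ n := by
  induction n with
  | zero =>
    rw [pow_zero, pow_zero, ← HahnSeries.single_zero_one, mapCoeff_hahnSingle, h1]
  | succ n ih => rw [pow_succ, pow_succ, mapCoeff_mul_of_map_mul φ hφ, ih]

end multiplicative

section leibniz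

variable (D : O k →ₗ[k] O k)

/-- A `k`-linear DERIVATION of `𝒪` acts as a derivation on `𝒪((ϖ))` coefficientwise
(Cauchy product rule). [folklore] -/
theorem mapCoeff_mul_of_leibniz (hD : ∀ f g : O k, D (f * g) = D f * g + f * D g)
    (F G : LaurentSeries (O k)) :
    mapCoeff k D (F * G) = mapCoeff k D F * G + F * mapCoeff k D G := by
  apply HahnSeries.ext; funext a
  simp only [HahnSeries.coeff_add', Pi.add_apply, mapCoeff_coeff]
  rw [HahnSeries.coeff_mul,
    HahnSeries.coeff_mul_left' F.isPWO_support (support_mapCoeff_subset D F),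
    HahnSeries.coeff_mul_right' G.isPWO_support (support_mapCoeff_subset D G), map_sum,
    ← Finset.sum_add_distrib]
  refine Finset.sum_congr rfl fun ij _ => ?_
  rw [hD, mapCoeff_coeff, mapCoeff_coeff]

/-- A derivation kills `1`, hence all monomials `ϖ^n`. [folklore] -/
theorem map_one_of_leibniz (hD : ∀ f g : O k, D (f * g) = D f * g + f * D g) : D 1 = 0 := by
  have h := hD 1 1
  rw [mul_one, one_mul, mul_one] at h
  -- h : D 1 = D 1 + D 1
  have : D 1 + D 1 = D 1 + 0 := by rw [add_zero]; exact h.symm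
  exact add_left_cancel this

/-- The power rule for a coefficientwise derivation. [folklore] -/
theorem mapCoeff_pow_of_leibniz (hD : ∀ f g : O k, D (f * g) = D f * g + f * D g)
    (F : LaurentSeries (O k)) (n : ℕ) :
    mapCoeff k D (F ^ (n + 1)) = ((n : LaurentSeries (O k)) + 1) * F ^ n * mapCoeff k D F := by
  induction n with
  | zero => rw [zero_add, pow_one, pow_zero, Nat.cast_zero, zero_add, one_mul, one_mul]
  | succ n ih =>
    rw [pow_succ, mapCoeff_mul_of_leibniz D hD, ih]
    push_cast
    ring

/-- A coefficientwise derivation kills `1 ∈ 𝒪((ϖ))`. [folklore] -/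
theorem mapCoeff_one_of_leibniz (hD : ∀ f g : O k, D (f * g) = D f * g + f * D g) :
    mapCoeff k D (1 : LaurentSeries (O k)) = 0 := by
  rw [← HahnSeries.single_zero_one, mapCoeff_hahnSingle, map_one_of_leibniz D hD,
    HahnSeries.single_eq_zero]

end leibniz

/-- The image of `𝒪[ϖ]` in `𝒪((ϖ))` is a sum of monomials. [folklore] -/
theorem algebraMap_C_mul_X_pow (c : O k) (n : ℕ) :
    algebraMap (Polynomial (O k)) (LaurentSeries (O k)) (Polynomial.C c * X ^ n) =
      HahnSeries.single (n : ℤ) c := by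
  rw [Polynomial.algebraMap_hahnSeries_apply, Polynomial.coe_mul, Polynomial.coe_pow,
    Polynomial.coe_C, Polynomial.coe_X, map_mul, map_pow, HahnSeries.ofPowerSeries_C,
    HahnSeries.ofPowerSeries_X, HahnSeries.single_pow, one_pow, HahnSeries.C_apply,
    HahnSeries.single_mul_single, zero_add, mul_one, nsmul_eq_mul, mul_one]

/-- … so the image of `p ∈ 𝒪[ϖ]` is the finite sum of the monomials `pₙ ϖ^n`. [folklore] -/
theorem algebraMap_eq_sum_single (p : Polynomial (O k)) :
    algebraMap (Polynomial (O k)) (LaurentSeries (O k)) p =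
      ∑ n ∈ Finset.range (p.natDegree + 1), HahnSeries.single (n : ℤ) (p.coeff n) := by
  conv_lhs => rw [p.as_sum_range_C_mul_X_pow]
  rw [map_sum]
  exact Finset.sum_congr rfl fun n _ => algebraMap_C_mul_X_pow _ _

/-- A coefficientwise map sends the image of `𝒪[ϖ]` into the image of `𝒪[ϖ]`. [folklore] -/
theorem mapCoeff_algebraMap (f : O k →ₗ[k] O k) (p : Polynomial (O k)) :
    mapCoeff k f (algebraMap (Polynomial (O k)) (LaurentSeries (O k)) p) =
      algebraMap (Polynomial (O k)) (LaurentSeries (O k))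
        (∑ n ∈ Finset.range (p.natDegree + 1), Polynomial.C (f (p.coeff n)) * X ^ n) := by
  rw [algebraMap_eq_sum_single, map_sum, map_sum]
  refine Finset.sum_congr rfl fun n _ => ?_
  rw [mapCoeff_hahnSingle, algebraMap_C_mul_X_pow]

/-- In particular it preserves algebraicity of the elements of `𝒪[ϖ]`. [folklore] -/
theorem mapCoeff_algebraMap_mem_odagger (f : O k →ₗ[k] O k) (p : Polynomial (O k)) :
    mapCoeff k f (algebraMap (Polynomial (O k)) (LaurentSeries (O k)) p) ∈ Odagger k := by
  rw [mapCoeff_algebraMap]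
  exact algebraMap_mem_odagger _

/-- `Q(F) ∈ 𝒪†_alg` for `F ∈ 𝒪†_alg` and any `Q ∈ 𝒪[ϖ][Y]`. [folklore] -/
theorem aeval_mem_odagger {F : LaurentSeries (O k)} (hF : F ∈ Odagger k)
    (Q : Polynomial (Polynomial (O k))) : aeval F Q ∈ Odagger k := by
  rw [mem_odagger_iff] at hF ⊢
  exact (Algebra.isAlgebraic_adjoin_singleton_iff.mpr hF) _ (aeval_mem_adjoin_singleton _ F)


/-- **Derivations preserve `𝒪†_alg`.** If `D` is a `k`-linear derivation of `𝒪` (e.g. `∂/∂zᵢ`,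
`tⱼ∂/∂tⱼ`), then the coefficientwise `D` maps algebraic Laurent series to algebraic Laurent
series: differentiating a minimal-degree relation `P(F) = 0` gives `P^D(F) + P'(F)·DF = 0` with
`P'(F) ≠ 0` (characteristic `0`), and `𝒪((ϖ))` is a domain. [folklore] -/
theorem mapCoeff_mem_odagger_of_leibniz [CharZero k] (D : O k →ₗ[k] O k)
    (hD : ∀ f g : O k, D (f * g) = D f * g + f * D g) {F : LaurentSeries (O k)}
    (hF : F ∈ Odagger k) : mapCoeff k D F ∈ Odagger k := by
  classical
  have hF' := (mem_odagger_iff F).mp hF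
  -- an annihilating polynomial of minimal degree
  have hex : ∃ d : ℕ, ∃ P : Polynomial (Polynomial (O k)),
      P ≠ 0 ∧ aeval F P = 0 ∧ P.natDegree = d := by
    obtain ⟨P, hP0, hPF⟩ := hF'
    exact ⟨_, P, hP0, hPF, rfl⟩
  obtain ⟨P, hP0, hPF, hPd⟩ := Nat.find_spec hex
  have hmin : ∀ Q : Polynomial (Polynomial (O k)), Q ≠ 0 → aeval F Q = 0 →
      P.natDegree ≤ Q.natDegree :=
    fun Q hQ0 hQF => hPd ▸ Nat.find_min' hex ⟨Q, hQ0, hQF, rfl⟩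
  set φ := algebraMap (Polynomial (O k)) (LaurentSeries (O k)) with hφ
  have hinj : Function.Injective φ := Polynomial.algebraMap_hahnSeries_injective ℤ
  -- `P` has positive degree
  have hd0 : P.natDegree ≠ 0 := by
    intro h0
    apply hP0
    rw [Polynomial.eq_C_of_natDegree_eq_zero h0] at hPF ⊢
    rw [Polynomial.aeval_C] at hPF
    rw [hinj (hPF.trans (map_zero φ).symm), map_zero]
  haveI : CharZero (Polynomial (O k)) :=
    charZero_of_injective_algebraMap (FaithfulSMul.algebraMap_injective k (Polynomial (O k)))
  set d := P.natDegree with hd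
  -- its derivative is non-zero, of smaller degree, hence does not kill `F`
  have hP'deg : (derivative P).natDegree < d := Polynomial.natDegree_derivative_lt hd0
  have hP'0 : derivative P ≠ 0 := by
    intro h
    have hc := Polynomial.coeff_derivative P (d - 1)
    rw [h, Polynomial.coeff_zero, Nat.sub_add_cancel (Nat.pos_of_ne_zero hd0)] at hc
    have h1 : ((d - 1 : ℕ) : Polynomial (O k)) + 1 = (d : Polynomial (O k)) := by
      rw [← Nat.cast_succ]; congr 1; omega
    rw [h1] at hc
    have : P.coeff d = 0 := by
      rcases mul_eq_zero.mp hc.symm with h2 | h2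
      · exact h2
      · exact absurd h2 (Nat.cast_ne_zero.mpr hd0)
    exact hP0 (Polynomial.leadingCoeff_eq_zero.mp this)
  have hP'F : aeval F (derivative P) ≠ 0 := fun h =>
    absurd (hmin _ hP'0 h) (not_le.mpr hP'deg)
  -- the chain rule `D(P(F)) = P^D(F) + P'(F) · DF`
  have hchain : mapCoeff k D (aeval F P) =
      (∑ i ∈ Finset.range (d + 1), mapCoeff k D (φ (P.coeff i)) * F ^ i) +
        aeval F (derivative P) * mapCoeff k D F := by
    rw [Polynomial.aeval_eq_sum_range, map_sum]
    simp_rw [Algebra.smul_def, mapCoeff_mul_of_leibniz D hD]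
    rw [Finset.sum_add_distrib]
    congr 1
    rw [Finset.sum_range_succ', pow_zero, mapCoeff_one_of_leibniz D hD, mul_zero, add_zero]
    simp_rw [mapCoeff_pow_of_leibniz D hD]
    rw [Polynomial.aeval_eq_sum_range' hP'deg, Finset.sum_mul]
    refine Finset.sum_congr rfl fun j _ => ?_
    rw [Polynomial.coeff_derivative, Algebra.smul_def, map_mul, map_add, map_natCast, map_one]
    ring
  have hS0 : (∑ i ∈ Finset.range (d + 1), mapCoeff k D (φ (P.coeff i)) * F ^ i) ∈ Odagger k :=
    sum_mem_odagger _ _ fun i _ =>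
      mul_mem_odagger (mapCoeff_algebraMap_mem_odagger D _) (pow_mem_odagger hF i)
  have hprod : aeval F (derivative P) * mapCoeff k D F =
      -(∑ i ∈ Finset.range (d + 1), mapCoeff k D (φ (P.coeff i)) * F ^ i) := by
    have h0 : mapCoeff k D (aeval F P) = 0 := by rw [hPF, map_zero]
    rw [hchain] at h0
    exact eq_neg_of_add_eq_zero_right h0
  rw [mem_odagger_iff]
  refine IsAlgebraic.of_mul (mem_nonZeroDivisors_of_ne_zero hP'F)
    ((mem_odagger_iff _).mp (aeval_mem_odagger hF _)) ?_
  rw [hprod]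
  exact (mem_odagger_iff _).mp (neg_mem_odagger hS0)


/-! ### D. Algebraic relations, and restrictions `zᵢ = c` -/

/-- Evaluating the double polynomial `Σ c(m,n) ϖ^m Y^n` at `Y = F`. [folklore] -/
theorem aeval_sum_monomial (F : LaurentSeries (O k)) (J : Finset (ℕ × ℕ)) (c : ℕ × ℕ → O k) :
    aeval F (∑ j ∈ J, Polynomial.C (Polynomial.C (c j) * X ^ j.1) * X ^ j.2) =
      ∑ j ∈ J, HahnSeries.single (j.1 : ℤ) (c j) * F ^ j.2 := by
  rw [map_sum]
  refine Finset.sum_congr rfl fun j _ => ?_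
  rw [map_mul, map_pow, Polynomial.aeval_C, Polynomial.aeval_X, algebraMap_C_mul_X_pow]

/-- The double polynomial `Σ_{(m,n) ∈ J} c(m,n) ϖ^m Y^n` is non-zero as soon as one coefficient
is. [folklore] -/
theorem sum_monomial_ne_zero (J : Finset (ℕ × ℕ)) (c : ℕ × ℕ → O k) {j₀ : ℕ × ℕ} (hj₀ : j₀ ∈ J)
    (hc : c j₀ ≠ 0) :
    (∑ j ∈ J, Polynomial.C (Polynomial.C (c j) * X ^ j.1) * X ^ j.2 :
      Polynomial (Polynomial (O k))) ≠ 0 := by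
  classical
  intro h
  have h1 := congrArg (fun P : Polynomial (Polynomial (O k)) => (P.coeff j₀.2).coeff j₀.1) h
  simp only [Polynomial.finsetSum_coeff, Polynomial.coeff_C_mul_X_pow, Polynomial.coeff_zero]
    at h1
  rw [Finset.sum_eq_single j₀, if_pos rfl, Polynomial.coeff_C_mul_X_pow, if_pos rfl] at h1
  · exact hc h1
  · intro j _ hj
    by_cases h2 : j₀.2 = j.2
    · rw [if_pos h2, Polynomial.coeff_C_mul_X_pow, if_neg]
      intro h3
      exact hj (Prod.ext h3.symm h2.symm)
    · rw [if_neg h2, Polynomial.coeff_zero]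
  · intro h2
    exact absurd hj₀ h2

/-- **A non-trivial relation `Σ c(m,n) ϖ^m F^n = 0` makes `F` algebraic.** [folklore] -/
theorem mem_odagger_of_relation {F : LaurentSeries (O k)} {J : Finset (ℕ × ℕ)} {c : ℕ × ℕ → O k}
    {j₀ : ℕ × ℕ} (hj₀ : j₀ ∈ J) (hc : c j₀ ≠ 0)
    (h : ∑ j ∈ J, HahnSeries.single (j.1 : ℤ) (c j) * F ^ j.2 = 0) : F ∈ Odagger k :=
  (mem_odagger_iff F).mpr ⟨_, sum_monomial_ne_zero J c hj₀ hc, by rw [aeval_sum_monomial, h]⟩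

/-- The image of `p ∈ 𝒪[ϖ]` in `𝒪((ϖ))`, written with a prescribed number of terms. [folklore] -/
theorem algebraMap_eq_sum_single' (p : Polynomial (O k)) {N : ℕ} (hN : p.natDegree < N) :
    algebraMap (Polynomial (O k)) (LaurentSeries (O k)) p =
      ∑ n ∈ Finset.range N, HahnSeries.single (n : ℤ) (p.coeff n) := by
  conv_lhs => rw [p.as_sum_range' N hN]
  rw [map_sum]
  refine Finset.sum_congr rfl fun n _ => ?_
  rw [← Polynomial.C_mul_X_pow_eq_monomial, algebraMap_C_mul_X_pow]

/-- **An algebraic `F` satisfies a non-trivial relation `Σ c(m,n) ϖ^m F^n = 0`** with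
coefficients `c(m,n) ∈ 𝒪` (unfold `P(F) = 0`, `P ∈ 𝒪[ϖ][Y]`). [folklore] -/
theorem exists_relation_of_mem_odagger {F : LaurentSeries (O k)} (hF : F ∈ Odagger k) :
    ∃ (J : Finset (ℕ × ℕ)) (c : ℕ × ℕ → O k), (∃ j₀ ∈ J, c j₀ ≠ 0) ∧
      ∑ j ∈ J, HahnSeries.single (j.1 : ℤ) (c j) * F ^ j.2 = 0 := by
  classical
  obtain ⟨P, hP0, hPF⟩ := (mem_odagger_iff F).mp hF
  set d := P.natDegree with hd
  set M := (Finset.range (d + 1)).sup fun n => (P.coeff n).natDegree with hM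
  have hMn : ∀ n ∈ Finset.range (d + 1), (P.coeff n).natDegree < M + 1 := fun n hn =>
    Nat.lt_succ_of_le (Finset.le_sup (f := fun n => (P.coeff n).natDegree) hn)
  refine ⟨Finset.range (M + 1) ×ˢ Finset.range (d + 1), fun j => (P.coeff j.2).coeff j.1, ?_, ?_⟩
  · refine ⟨((P.coeff d).natDegree, d), ?_, ?_⟩
    · rw [Finset.mem_product, Finset.mem_range, Finset.mem_range]
      exact ⟨hMn d (Finset.self_mem_range_succ d), Nat.lt_succ_self d⟩
    · show (P.coeff d).leadingCoeff ≠ 0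
      rw [Ne, Polynomial.leadingCoeff_eq_zero]
      exact Polynomial.leadingCoeff_ne_zero.mpr hP0
  · rw [Finset.sum_product, ← hPF, Polynomial.aeval_eq_sum_range, Finset.sum_comm]
    refine Finset.sum_congr rfl fun n hn => ?_
    rw [Algebra.smul_def, algebraMap_eq_sum_single' (P.coeff n) (hMn n hn), Finset.sum_mul]

/-- Coefficientwise ring endomorphisms transport relations. [folklore] -/
theorem mapCoeff_relation (φ : O k →ₗ[k] O k) (h1 : φ 1 = 1)
    (hφ : ∀ f g : O k, φ (f * g) = φ f * φ g) (F : LaurentSeries (O k)) (J : Finset (ℕ × ℕ))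
    (c : ℕ × ℕ → O k) :
    mapCoeff k φ (∑ j ∈ J, HahnSeries.single (j.1 : ℤ) (c j) * F ^ j.2) =
      ∑ j ∈ J, HahnSeries.single (j.1 : ℤ) (φ (c j)) * mapCoeff k φ F ^ j.2 := by
  rw [map_sum]
  refine Finset.sum_congr rfl fun j _ => ?_
  rw [mapCoeff_mul_of_map_mul φ hφ, mapCoeff_hahnSingle, mapCoeff_pow_of_map_mul φ h1 hφ]

/-- **Injective `k`-algebra endomorphisms of `𝒪`, applied coefficientwise, preserve `𝒪†_alg`.**
[folklore] -/
theorem mapCoeff_mem_odagger_of_injective (φ : O k →ₗ[k] O k) (h1 : φ 1 = 1)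
    (hφ : ∀ f g : O k, φ (f * g) = φ f * φ g) (hinj : Function.Injective φ)
    {F : LaurentSeries (O k)} (hF : F ∈ Odagger k) : mapCoeff k φ F ∈ Odagger k := by
  obtain ⟨J, c, ⟨j₀, hj₀, hc⟩, hrel⟩ := exists_relation_of_mem_odagger hF
  have h := congrArg (mapCoeff k φ) hrel
  rw [mapCoeff_relation φ h1 hφ, map_zero] at h
  exact mem_odagger_of_relation hj₀ (fun h0 => hc (hinj (h0.trans (map_zero φ).symm))) h

/-! #### Restriction to `zᵢ = 0` -/

/-- A monomial as a scalar multiple of the normalised one. [folklore] -/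
theorem single_eq_smul_mono (m : Mono) (r : k) : AddMonoidAlgebra.single m r = r • mono k m := by
  rw [mono, AddMonoidAlgebra.smul_single, smul_eq_mul, mul_one]

/-- `f ↦ f|_{zᵢ=0}` does not change the coefficients of `zᵢ`-free monomials. [folklore] -/
theorem coeff_restr_zero (i : ℕ) (f : O k) (ν : Mono) (hν : ν.1 i = 0) :
    (restr k i 0 f).coeff ν = f.coeff ν := by
  classical
  induction f using AddMonoidAlgebra.induction_linear with
  | zero => simp
  | add f g hf hg => simp only [map_add, AddMonoidAlgebra.coeff_add, Finsupp.add_apply, hf, hg]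
  | single μ a =>
    rw [single_eq_smul_mono, map_smul, restr_mono]
    by_cases hμ : μ.1 i = 0
    · rw [hμ, pow_zero, one_smul, Finsupp.erase_of_notMem_support (f := μ.1) (by simpa using hμ)]
    · have hne : μ ≠ ν := fun h => hμ (h ▸ hν)
      rw [zero_pow hμ, zero_smul, smul_zero, AddMonoidAlgebra.coeff_zero, Finsupp.zero_apply,
        AddMonoidAlgebra.coeff_smul, Finsupp.smul_apply, mono, AddMonoidAlgebra.coeff_single,
        Finsupp.single_eq_of_ne hne.symm, smul_zero]

/-- … hence `f|_{zᵢ=0} ≠ 0` if `f` has a `zᵢ`-free monomial. [folklore] -/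
theorem restr_zero_ne_zero (i : ℕ) {f : O k} {ν : Mono} (hν : ν.1 i = 0) (h : f.coeff ν ≠ 0) :
    restr k i 0 f ≠ 0 := fun h0 => h (by rw [← coeff_restr_zero i f ν hν, h0]; rfl)

/-- Exponent arithmetic: `zᵢ^r · (μ / zᵢ^r) = μ` when `zᵢ^r ∣ μ`. [folklore] -/
theorem exponent_add_tsub_cancel (i r : ℕ) (μ : Mono) (h : r ≤ μ.1 i) :
    ((Finsupp.single i r, 0) : Mono) + (μ.1 - Finsupp.single i r, μ.2) = μ :=
  Prod.ext (add_tsub_cancel_of_le (Finsupp.single_le_iff.mpr h)) (zero_add μ.2)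

/-- **Restriction to `zᵢ = 0` preserves `𝒪†_alg`.** Take a non-trivial relation
`Σ c(m,n) ϖ^m F^n = 0`, divide all `c(m,n)` by the largest common power `zᵢ^r` (so that some
`c(m,n)/zᵢ^r` has a `zᵢ`-free monomial), cancel `zᵢ^r` in the domain `𝒪((ϖ))`, and restrict.
[folklore] -/
theorem mapCoeff_restr_zero_mem_odagger (i : ℕ) {F : LaurentSeries (O k)} (hF : F ∈ Odagger k) :
    mapCoeff k (restr k i 0) F ∈ Odagger k := by
  classical
  obtain ⟨J, c, ⟨j₁, hj₁, hc₁⟩, hrel⟩ := exists_relation_of_mem_odagger hF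
  -- all monomials occurring in the coefficients, and the least `zᵢ`-exponent among them
  set S : Finset Mono := J.biUnion fun j => (c j).coeff.support with hS
  have hSne : S.Nonempty := by
    obtain ⟨μ, hμ⟩ := Finsupp.support_nonempty_iff.mpr (mt AddMonoidAlgebra.coeff_eq_zero.mp hc₁)
    exact ⟨μ, Finset.mem_biUnion.mpr ⟨j₁, hj₁, hμ⟩⟩
  set r : ℕ := (S.image fun μ : Mono => μ.1 i).min' (hSne.image _) with hr
  have hr_le : ∀ j ∈ J, ∀ μ ∈ (c j).coeff.support, r ≤ μ.1 i := fun j hj μ hμ =>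
    Finset.min'_le _ _ (Finset.mem_image.mpr ⟨μ, Finset.mem_biUnion.mpr ⟨j, hj, hμ⟩, rfl⟩)
  obtain ⟨μ₀, hμ₀S, hμ₀r⟩ : ∃ μ₀ ∈ S, μ₀.1 i = r := by
    simpa only [Finset.mem_image] using Finset.min'_mem (S.image fun μ : Mono => μ.1 i) (hSne.image _)
  obtain ⟨j₀, hj₀, hμ₀⟩ := Finset.mem_biUnion.mp hμ₀S
  -- divide every coefficient by `zᵢ^r`
  set g : Mono := (Finsupp.single i r, 0) with hg
  set d : ℕ × ℕ → O k := fun j => AddMonoidAlgebra.divOf (c j) g with hd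
  have hcd : ∀ j ∈ J, c j = mono k g * d j := by
    intro j hj
    have hmod : AddMonoidAlgebra.modOf (c j) g = 0 := by
      apply AddMonoidAlgebra.coeff_injective
      ext μ
      by_cases hμ : ∃ e, μ = g + e
      · rw [AddMonoidAlgebra.coeff_modOf_of_exists_add _ _ _ hμ]; rfl
      · rw [AddMonoidAlgebra.coeff_modOf_of_not_exists_add _ _ _ hμ, AddMonoidAlgebra.coeff_zero,
          Finsupp.zero_apply]
        by_contra hne
        exact hμ ⟨_, (exponent_add_tsub_cancel i r μ (hr_le j hj μ (Finsupp.mem_support_iff.mpr hne))).symm⟩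
    have := AddMonoidAlgebra.divOf_add_modOf (c j) g
    rw [hmod, add_zero, AddMonoidAlgebra.of'_apply] at this
    exact this.symm
  -- the relation divided by `zᵢ^r`
  have hrel' : ∑ j ∈ J, HahnSeries.single (j.1 : ℤ) (d j) * F ^ j.2 = 0 := by
    have h2 : HahnSeries.C (mono k g) * ∑ j ∈ J, HahnSeries.single (j.1 : ℤ) (d j) * F ^ j.2 = 0 := by
      rw [← hrel, Finset.mul_sum]
      refine Finset.sum_congr rfl fun j hj => ?_
      rw [← mul_assoc, HahnSeries.C_apply, HahnSeries.single_mul_single, zero_add, ← hcd j hj]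
    rcases mul_eq_zero.mp h2 with h0 | h0
    · exact absurd h0 (HahnSeries.C_ne_zero (AddMonoidAlgebra.single_ne_zero.mpr one_ne_zero))
    · exact h0
  -- restrict it to `zᵢ = 0`
  have h3 := congrArg (mapCoeff k (restr k i 0)) hrel'
  rw [mapCoeff_relation (restr k i 0) (restr_one i 0) (restr_mul i 0), map_zero] at h3
  refine mem_odagger_of_relation hj₀ ?_ h3
  -- non-triviality: `d j₀` has the `zᵢ`-free monomial `μ₀ / zᵢ^r`
  refine restr_zero_ne_zero i (ν := (μ₀.1 - Finsupp.single i r, μ₀.2)) ?_ ?_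
  · show (μ₀.1 - Finsupp.single i r) i = 0
    rw [Finsupp.tsub_apply, Finsupp.single_eq_same, hμ₀r, Nat.sub_self]
  · rw [hd]
    dsimp only
    rw [AddMonoidAlgebra.coeff_divOf, exponent_add_tsub_cancel i r μ₀ (hr_le j₀ hj₀ μ₀ hμ₀)]
    exact Finsupp.mem_support_iff.mp hμ₀


/-! #### Translations and restriction to `zᵢ = c` -/

/-- Powers of the variable `zᵢ`. [folklore] -/
theorem mono_single_pow (i n : ℕ) :
    mono k (Finsupp.single i 1, 0) ^ n = mono k (Finsupp.single i n, 0) := by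
  rw [mono, mono, AddMonoidAlgebra.single_pow, one_pow]
  congr 1
  ext j <;> simp [Finsupp.smul_single]

/-- `z^a t^b = zᵢ^{aᵢ} · z^{a|aᵢ:=0} t^b`. [folklore] -/
theorem mono_eq_pow_mul (i : ℕ) (m : Mono) :
    mono k m = mono k (Finsupp.single i 1, 0) ^ (m.1 i) * mono k (m.1.erase i, m.2) := by
  rw [mono_single_pow, mono_mul_mono, Prod.mk_add_mk, Finsupp.single_add_erase, zero_add]

/-- **Translations `zᵢ ↦ zᵢ + c` of `𝒪`**: an injective `k`-algebra endomorphism `τ` with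
`f|_{zᵢ = c} = (τ f)|_{zᵢ = 0}` for all `f`. [folklore] -/
theorem exists_translate (i : ℕ) (c : k) :
    ∃ τ : O k →ₐ[k] O k, Function.Injective τ ∧ ∀ f : O k, restr k i c f = restr k i 0 (τ f) := by
  classical
  set zi : O k := mono k (Finsupp.single i 1, 0) with hzi
  -- the substitutions `zᵢ ↦ zᵢ + a`, `a : k`, as `k`-algebra maps
  let Φ : k → (Multiplicative Mono →* O k) := fun a =>
    { toFun := fun m => (zi + algebraMap k (O k) a) ^ ((Multiplicative.toAdd m).1 i) *
        mono k ((Multiplicative.toAdd m).1.erase i, (Multiplicative.toAdd m).2)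
      map_one' := by
        simp only [toAdd_one, Prod.fst_zero, Finsupp.coe_zero, Pi.zero_apply, pow_zero,
          Finsupp.erase_zero, Prod.snd_zero, one_mul]
        exact mono_zero
      map_mul' := fun m m' => by
        simp only [toAdd_mul, Prod.fst_add, Prod.snd_add, Finsupp.add_apply, pow_add,
          Finsupp.erase_add]
        rw [← Prod.mk_add_mk, ← mono_mul_mono]
        ring }
  let T : k → (O k →ₐ[k] O k) := fun a => AddMonoidAlgebra.lift k (O k) Mono (Φ a)
  have hT : ∀ (a : k) (m : Mono), T a (mono k m) =
      (zi + algebraMap k (O k) a) ^ (m.1 i) * mono k (m.1.erase i, m.2) := by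
    intro a m
    show AddMonoidAlgebra.lift k (O k) Mono (Φ a) (AddMonoidAlgebra.single m 1) = _
    rw [AddMonoidAlgebra.lift_single, one_smul]
    rfl
  have hTz : ∀ a : k, T a zi = zi + algebraMap k (O k) a := by
    intro a
    rw [hzi, hT, Finsupp.single_eq_same, pow_one, Finsupp.erase_single, ← hzi]
    show _ * mono k 0 = _
    rw [mono_zero, mul_one]
  have hTfree : ∀ (a : k) (m : Mono), m.1 i = 0 → T a (mono k m) = mono k m := by
    intro a m hm
    rw [hT, hm, pow_zero, one_mul, Finsupp.erase_of_notMem_support (f := m.1) (by simpa using hm)]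
  have herase : ∀ m : Mono, ((m.1.erase i, m.2) : Mono).1 i = 0 := fun m => Finsupp.erase_same
  -- `T (-a) ∘ T a = id`
  have hTT : ∀ (a : k) (f : O k), T (-a) (T a f) = f := by
    intro a f
    induction f using AddMonoidAlgebra.induction_linear with
    | zero => rw [map_zero, map_zero]
    | add f g hf hg => rw [map_add, map_add, hf, hg]
    | single m r =>
      rw [single_eq_smul_mono, map_smul, map_smul, hT, map_mul, map_pow, map_add, hTz,
        AlgHom.commutes, hTfree (-a) _ (herase m), map_neg, neg_add_cancel_right,
        ← mono_eq_pow_mul]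
  refine ⟨T c, Function.LeftInverse.injective (g := T (-c)) (hTT c), fun f => ?_⟩
  -- `restr c = restr 0 ∘ T c`: by linearity it suffices to check monomials
  let ρ : O k →+* O k :=
    { toFun := restr k i 0, map_one' := restr_one i 0, map_mul' := restr_mul i 0,
      map_zero' := map_zero _, map_add' := map_add _ }
  have hρ : ∀ f, restr k i 0 f = ρ f := fun _ => rfl
  have hρz : ρ zi = 0 := by
    rw [← hρ, hzi, restr_mono, Finsupp.single_eq_same, pow_one, zero_smul]
  have hρa : ∀ a : k, ρ (algebraMap k (O k) a) = algebraMap k (O k) a := by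
    intro a
    rw [← hρ, Algebra.algebraMap_eq_smul_one, map_smul, restr_one]
  induction f using AddMonoidAlgebra.induction_linear with
  | zero => rw [map_zero, map_zero, map_zero]
  | add f g hf hg => rw [map_add, map_add, map_add, hf, hg]
  | single m r =>
    rw [single_eq_smul_mono, map_smul, map_smul, map_smul, hT, hρ, map_mul, map_pow, map_add,
      hρz, hρa, zero_add, ← hρ, restr_mono, restr_mono, ← map_pow, ← Algebra.smul_def]
    congr 1
    dsimp only
    rw [Finsupp.erase_same, pow_zero, one_smul,
      Finsupp.erase_of_notMem_support (f := m.1.erase i) (by simp)]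


/-- **Restrictions `zᵢ = c` preserve `𝒪†_alg`** (translate `zᵢ ↦ zᵢ + c`, then restrict to
`zᵢ = 0`). [folklore] -/
theorem mapCoeff_restr_mem_odagger (i : ℕ) (c : k) {F : LaurentSeries (O k)}
    (hF : F ∈ Odagger k) : mapCoeff k (restr k i c) F ∈ Odagger k := by
  obtain ⟨τ, hτ, hτr⟩ := exists_translate i c
  have h1 : restr k i c = restr k i 0 ∘ₗ τ.toLinearMap := LinearMap.ext fun f => hτr f
  rw [h1, mapCoeff_comp_apply]
  exact mapCoeff_restr_zero_mem_odagger i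
    (mapCoeff_mem_odagger_of_injective τ.toLinearMap (map_one τ) (map_mul τ) hτ hF)

/-! ### E. The generators of Théorème 1.7 lie in `𝒪†_alg`; the printed form of the theorem -/

/-- **Type (a) generators are algebraic**: `∂G/∂zᵢ - G|_{zᵢ=1} + G|_{zᵢ=0} ∈ 𝒪†_alg` for
`G ∈ 𝒪†_alg`. [Ayoub, revisited note, Théorème 1.7 (a)] [cite: AyoubRelKZRevisited, Théorème 1.7] -/
theorem mapCoeff_relA_mem_odagger [CharZero k] (i : ℕ) {G : LaurentSeries (O k)}
    (hG : G ∈ Odagger k) : mapCoeff k (relA k i) G ∈ Odagger k := by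
  rw [relA, mapCoeff_add_map, mapCoeff_sub_map]
  exact add_mem_odagger (sub_mem_odagger (mapCoeff_mem_odagger_of_leibniz _ (dz_mul i) hG)
    (mapCoeff_restr_mem_odagger i 1 hG)) (mapCoeff_restr_mem_odagger i 0 hG)

/-- **Type (b) generators are algebraic**: `tⱼ ∂H/∂tⱼ ∈ 𝒪†_alg` for `H ∈ 𝒪†_alg`.
[Ayoub, revisited note, Théorème 1.7 (b)] [cite: AyoubRelKZRevisited, Théorème 1.7] -/
theorem mapCoeff_euler_mem_odagger [CharZero k] (j : ℕ) {H : LaurentSeries (O k)}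
    (hH : H ∈ Odagger k) : mapCoeff k (euler k j) H ∈ Odagger k :=
  mapCoeff_mem_odagger_of_leibniz _ (euler_mul j) hH

/-- **All of Ayoub's generators lie in `𝒪†_alg`.**
[Ayoub, revisited note, Théorème 1.7] [cite: AyoubRelKZRevisited, Théorème 1.7] -/
theorem ayoubGenerators_subset_odagger [CharZero k] : ayoubGenerators k ⊆ Odagger k := by
  rintro x (⟨G, hG, i, rfl⟩ | ⟨H, hH, j, rfl⟩)
  · exact mapCoeff_relA_mem_odagger i hG
  · exact mapCoeff_euler_mem_odagger j hH

/-- … hence so does their `k`-span (the right-hand side of Théorème 1.7 is a subspace of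
`𝒪†_alg`, as the printed statement presupposes).
[Ayoub, revisited note, Théorème 1.7] [cite: AyoubRelKZRevisited, Théorème 1.7] -/
theorem span_ayoubGenerators_subset_odagger [CharZero k] :
    (Submodule.span k (ayoubGenerators k) : Set (LaurentSeries (O k))) ⊆ Odagger k := by
  obtain ⟨S, hS⟩ := exists_submodule_coe_eq_odagger (k := k)
  rw [← hS]
  exact Submodule.span_le.mpr (hS.symm ▸ ayoubGenerators_subset_odagger)

/-- **Théorème 1.7 in its printed form, from the named fact.** Ayoub states: "le noyau de (5)
[`∫ : 𝒪†_alg → k((ϖ))`] est le sous-`k`-espace vectoriel engendré par les éléments (a), (b)" —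
an EQUALITY of subsets of `𝒪((ϖ))`, which presupposes that the span lies inside `𝒪†_alg`.
The vendored fact `ayoub_relativeKZ_revisited` only quantifies over `F ∈ 𝒪†_alg`; combined with
`span_ayoubGenerators_subset_odagger` (proved above, unconditionally) it yields the printed
equality `{F ∈ 𝒪†_alg | ∫ F = 0} = span_k (generators)`.
[Ayoub, revisited note, Théorème 1.7] [cite: AyoubRelKZRevisited, Théorème 1.7] -/
theorem ayoub_relativeKZ_revisited.ker_eq_span (h : ayoub_relativeKZ_revisited)
    (k : Type) [Field k] [CharZero k] (hk : Nonempty (k →+* ℂ)) :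
    {F : LaurentSeries (O k) | F ∈ Odagger k ∧ intLaurent k F = 0} =
      Submodule.span k (ayoubGenerators k) := by
  ext F
  refine ⟨fun hF => (h k hk F hF.1).mp hF.2, fun hF => ?_⟩
  have hF' : F ∈ Odagger k := span_ayoubGenerators_subset_odagger hF
  exact ⟨hF', (h k hk F hF').mpr hF⟩

end Literature.NumberTheory.Transcendental.AyoubRel
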